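import Summits.CriticalPhenomena.PercolationContinuityZ3.Theorems.PercNearOneGluingNoHeavyQuantGluedTransfer
import Summits.CriticalPhenomena.PercolationContinuityZ3.Theorems.PercNearOneGluingNoHeavyQuantGluedPieceSlice
import HarnessLib

/-!
# QUANT lane R8, T-DEC: ERRATUM AND REPAIR of `LawDec.GluedDominated` — the typed certificate statement is FALSE in the degenerate case `B = 0`
# (first factor `δ₀`, gate `a < 1`: the gated first factor has target `0`, no low atom, and cannot pay the gate zero), `not_gluedDominated`; the intended
# statement `GluedDominated'` (= the same with `1 ≤ B`) and the reductions re-proved from it, the case `B = 0` of the band being `sdec_glued`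
# (arm-1 gen 58, architect — same seat, same day as `…QuantGluedDomination`)

builds on p205010 (kernel theorem, internal audit signed; external expert review pending)

Statement + support file (`--supports stmt-CriticalPhenomena-4575`), QUANT lane seat prim-quant-arm-1 (gen 58, architect); memo
`run/shared/lean/prim/quant/prim-quant-arm-1-g58/ARCH-G58.md` §0 (7).  One `@[conjecture]` (`GluedDominated'`), theorems; standard axioms, no sorries.

WHAT WAS WRONG.  `GluedDominated` (`…QuantGluedDomination`, this seat) quantifies over all `B` with `xB ≤ S ≤ B`; for `B = 0` it forces `S = 0`, the gated
first factor `gate_a δ₀ = δ₀` has target `aS = 0` and NO low atom, so every admissible `coefAt 0 J α′ β′ 0 = −β′ 0 ≤ 0`, while the gate row asks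
`(1−a)·e(0) ≤ (1−a)·coefAt … 0` for certificates with `e(0) = α 0 > 0` (the zero IS a low of `ν_a = gate_a t`, target `am > 0`): impossible for `a < 1`.
**`not_gluedDominated`** records the witness (`x = q = 9/10`, `g = 1`, `r = 1`, `k = 3`, `a = 1/2`, `S = 0`, `B = 0`, `j = 0`, `p ≡ 1`, `α ≡ 1/2`).  The glued-piece
slice itself is TRUE at `B = 0` (`β = δ₀`, `β ∗ t = t`, `sdec_glued`); only the certificate form degenerates.  All the numerical evidence quoted for `GluedDominated`
(kit j287963–66, the local LP probes) has `B ≥ 1`.  The consequences `sdec_gluedPiece_band_of_dominated`, `gluedPieceSlice_of_dominated`,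
`sdec_cons_of_okPieces_of_dominated` remain true statements (ex falso) but are VOID; use the primed versions below.

THE REPAIR.
* **`LawDec.GluedDominated'`** (`@[conjecture]`): `GluedDominated` with the extra hypothesis `1 ≤ B` (then `S ≥ x > 0`, the zero is a low of the gated first
  factor at every layer, and the certificate can pay the gate row).  EVIDENCE: as recorded for `GluedDominated` (all of it had `B ≥ 1`).
* **`sdec_gluedPiece_band_of_dominated'`**: `GluedDominated' →` the glued-piece slice in the band, for EVERY `B` (`B = 0` by `sdec_glued`, `B ≥ 1` verbatim as before);
  **`gluedPieceSlice_of_dominated'`**: `GluedDominated' →` the hypothesis `hGPS` of `sdec_cons_of_okPieces` (through `gluedPieceSlice_of_band`);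
  **`sdec_cons_of_okPieces_of_dominated'`**.
So the dependency of record is: band ⟸ `GluedDominated'` ⟸ (single-layer route: `…QuantGluedTransfer`, `…QuantGluedDeepTransfer`, LEMMA W, gate row).

HONEST STATUS.  `GluedDominated` REFUTED (degenerate corner, here); `GluedDominated'` OPEN; the band, `SiblingStep`, `FarTreeRow` OPEN; RATE class (log\*) /
honest sentence of `run/shared/lean/prim/quant/README.md` unchanged.  [this work].  Nothing here is cited as a published result.  The gluing rows served
[cite: KozmaNitzan2024, Conjecture 3 (p. 15)]; product measure [cite: Grimmett1999, §1.3 p. 10].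
-/

noncomputable section

open scoped BigOperators

namespace Summit.CriticalPhenomena.PercolationContinuityZ3.Theorems
namespace Quant

open Finset

namespace LawDec

/-- the point mass `δ_K` -/
local notation3 "δ[" K "]" => (fun k : ℕ => if k = (K : ℕ) then (1 : ℝ) else 0)

/-- the two-point law `{lo, lo+K; g}` = `lo` sure relays and a blob of size `K` at gate `g` -/
local notation3 "TPL[" lo ", " K ", " g "]" => lconv lo K δ[lo] (gate δ[K] g)

/-! ### The refutation of the unguarded statement -/

/-- **`GluedDominated` AS TYPED IS FALSE** (degenerate corner `B = 0`, `a < 1`): with `x = q = 9/10`, `g = 1`, `r = 1`, `k = 3`, `a = 1/2`, `S = 0`, `B = 0`,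
`j = 0`, the price system `p ≡ 1`, `α ≡ 1/2` of `{0..4}` at `(9/20, 9/5, 0)` is admissible (the only low is `0`, its absorbers are the giants `1..4` at
rate `9/11 ≥ 1/2`), but every `J ≤ 0` has no low at target `0`, so `coefAt 0 J α′ β′ 0 = −β′ 0 ≤ 0` and the gate row `(1/2)·(1/2) ≤ (1/2)·(−β′ 0)` fails.
[this work] -/
theorem not_gluedDominated : ¬ GluedDominated := by
  intro h
  obtain ⟨J, α', β', lam, hJB, hβ', -, -, hgate⟩ :=
    h (9 / 10) (1 / 2) (9 / 10) 1 0 0 1 3 0 (fun _ => 1 / 2) (fun _ => 1)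
      (by norm_num) (by norm_num) (by norm_num) (by norm_num) (by norm_num) (by norm_num) (by norm_num) le_rfl le_rfl (by norm_num)
      (by norm_num) (by push_cast; norm_num) (by push_cast; norm_num) (by push_cast; norm_num) (by push_cast; norm_num) (by norm_num)
      (fun _ => by norm_num)
      (by
        intro l h' hl _ _ hcomp
        have hl0 : l = 0 := by omega
        subst hl0
        have hh1 : 0 + 1 ≤ h' := by
          rcases hcomp with hg | hm
          · exact hg
          · by_contra hc
            have h0 : h' = 0 := by omega
            subst h0
            push_cast at hm
            norm_num at hm
        show (1 / 2 : ℝ) ≤ usage (1 / 2 * (9 / 10)) _ 0 0 h' * 1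
        rw [usage_giant_eq _ _ 0 0 h' hh1]
        norm_num)
  have hJ0 : J = 0 := by omega
  subst hJ0
  simp only [coefAt] at hgate
  norm_num at hgate
  have := hβ' 0
  linarith

/-! ### The guarded statement and the reductions -/

/-- **CONJECTURE (single-layer domination of the certificates of the glued-piece slice; the GUARDED form of `GluedDominated`).**  Verbatim `GluedDominated`
(`…QuantGluedDomination`) with the extra hypothesis `1 ≤ B` (a non-trivial first factor: then `S ≥ x > 0` and the zero is a low of `gate_a β`).  EVIDENCE: all the
evidence recorded for `GluedDominated` (it had `B ≥ 1` throughout).  Implies the band (`sdec_gluedPiece_band_of_dominated'`). [this work] [status: open] -/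
@[conjecture] def GluedDominated' : Prop :=
  ∀ (x a q g S : ℝ) (B r k j : ℕ) (α p : ℕ → ℝ),
    0 < x → x < 1 → 0 < a → a ≤ 1 → 0 < q → q < 1 → 0 ≤ g → g ≤ 1 → 1 ≤ r → 1 ≤ k →
    x ≤ q * g → 2 * (r : ℝ) < q * ((r : ℝ) + k * g) → q * ((r : ℝ) + k * g) - r < (k : ℝ) * x →
    1 ≤ B → x * (B : ℝ) ≤ S → S ≤ (B : ℝ) → j < B + (r + k) →
    (∀ h, 0 ≤ p h) →
    (∀ l h, l ≤ j → 2 * (l : ℝ) < a * (S + q * ((r : ℝ) + k * g)) → h ≤ B + (r + k) →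
      (j + 1 ≤ h ∨ a * (S + q * ((r : ℝ) + k * g)) < (l : ℝ) + h) →
      α l ≤ usage (a * x) (a * (S + q * ((r : ℝ) + k * g))) j l h * p h) →
    ∃ (J : ℕ) (α' β' : ℕ → ℝ) (lam : ℝ), J ≤ B ∧ (∀ h, 0 ≤ β' h) ∧
      (∀ l h, l ≤ J → 2 * (l : ℝ) < a * S → h ≤ B → (J + 1 ≤ h ∨ a * S < (l : ℝ) + h) →
        α' l ≤ usage (a * x) (a * S) J l h * β' h) ∧
      (∀ h, h ≤ B → gluedPullback (a * (S + q * ((r : ℝ) + k * g))) q g j r k α p h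
        ≤ coefAt (a * S) J α' β' h + lam * ((h : ℝ) - S)) ∧
      (1 - a) * coefAt (a * (S + q * ((r : ℝ) + k * g))) j α p 0 ≤ (1 - a) * coefAt (a * S) J α' β' 0


/-- **`GluedDominated'` ⟹ THE GLUED-PIECE SLICE IN THE BAND** — as `sdec_gluedPiece_band_of_dominated` but from the guarded conjecture, for every `B`:
`B = 0` forces `β = δ₀`, `β ∗ t = t`, SDEC by `sdec_glued`; `B ≥ 1` as before (strong duality, the dominating layer, the mean identity, the gate row). [this work] -/
theorem sdec_gluedPiece_band_of_dominated' (hD : GluedDominated') {x : ℝ} (hx0 : 0 < x) (hx1 : x < 1) {B : ℕ} {β : ℕ → ℝ}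
    (β0 : ∀ h, 0 ≤ β h) (βM : ∀ h, B < h → β h = 0) (β1 : ∑ h ∈ Finset.range (B + 1), β h = 1)
    (hta : x * (B : ℝ) ≤ ∑ h ∈ Finset.range (B + 1), (h : ℝ) * β h) (hS : SDEC x B β)
    (q g : ℝ) (r k : ℕ) (hq0 : 0 < q) (hq1 : q < 1) (hg0 : 0 ≤ g) (hg1 : g ≤ 1) (hr : 1 ≤ r) (hk : 1 ≤ k)
    (hxqg : x ≤ q * g) (hband1 : 2 * (r : ℝ) < q * ((r : ℝ) + k * g)) (hband2 : q * ((r : ℝ) + k * g) - r < (k : ℝ) * x) :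
    SDEC x (B + (r + k)) (lconv B (r + k) β (gate (TPL[r, k, g]) q)) := by
  by_cases hB1 : 1 ≤ B
  swap
  · -- B = 0: β = δ₀ and β ∗ t = t, SDEC by `sdec_glued`
    have hB0 : B = 0 := by omega
    subst hB0
    have hβ0 : β 0 = 1 := by simpa using β1
    have eβ : β = fun i => if i = 0 then (1 : ℝ) else 0 := by
      funext i
      by_cases hi : i = 0
      · rw [if_pos hi, hi, hβ0]
      · rw [if_neg hi]; exact βM i (by omega)
    obtain ⟨t0, tM, t1, tmn⟩ := glued_laws q g r k hq0.le hq1.le hg0 hg1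
    have e : lconv 0 (r + k) β (gate (TPL[r, k, g]) q) = gate (TPL[r, k, g]) q := by
      funext u; rw [eβ]; exact lconv_delta_left 0 (r + k) _ tM u
    rw [e, Nat.zero_add]
    exact sdec_glued x q g r k hx0 hx1 hq0 hq1.le hg0 hg1 hxqg
  set S : ℝ := ∑ h ∈ Finset.range (B + 1), (h : ℝ) * β h with hSdef
  set m : ℝ := q * ((r : ℝ) + k * g) with hmdef
  set t : ℕ → ℝ := gate (TPL[r, k, g]) q with htdef
  obtain ⟨t0, tM, t1, tmn⟩ := glued_laws q g r k hq0.le hq1.le hg0 hg1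
  -- mean of β is at most its top
  have hSB : S ≤ (B : ℝ) := by
    have : ∑ h ∈ Finset.range (B + 1), (h : ℝ) * β h ≤ ∑ h ∈ Finset.range (B + 1), (B : ℝ) * β h :=
      Finset.sum_le_sum fun h hh => mul_le_mul_of_nonneg_right
        (by exact_mod_cast Nat.lt_succ_iff.1 (Finset.mem_range.1 hh)) (β0 h)
    rw [← Finset.mul_sum, β1, mul_one] at this
    exact this
  intro a ha0 ha1 j hj
  -- law facts of ν_a = gate (β ∗ t) a
  have c1 : ∑ h ∈ Finset.range (B + (r + k) + 1), lconv B (r + k) β t h = 1 := sum_lconv B (r + k) β t β1 t1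
  obtain ⟨n0, nM, n1⟩ := gate_laws (B + (r + k)) (lconv B (r + k) β t) a ha0.le ha1
    (lconv_nonneg B (r + k) β t β0 t0) (fun h hh => lconv_eq_zero B (r + k) β t h hh) c1
  have nmean : ∑ h ∈ Finset.range (B + (r + k) + 1), (h : ℝ) * gate (lconv B (r + k) β t) a h = a * (S + m) := by
    rw [sum_mul_gate, sum_mul_lconv B (r + k) β t β1 t1, tmn]
  have hy0 : 0 < a * x := mul_pos ha0 hx0
  have hy1 : a * x < 1 := by nlinarith
  rw [decAt_iff_decAtT, nmean, decAtT_iff_prices (a * x) _ j (B + (r + k)) _ hy0 hy1 nM n1]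
  intro α p hp hαp
  have hjM : j ≤ B + (r + k) := hj.le
  -- the certificate functional
  have hfun := dual_functional_eq (a * (S + m)) j (B + (r + k)) α p (gate (lconv B (r + k) β t) a) hjM
  rw [htdef, glued_functional_eq B r k β (coefAt (a * (S + m)) j α p) q g a hr] at hfun
  -- the dominating layer
  obtain ⟨J, α', β', lam, hJB, hβ', hαβ', hrows, hgate⟩ :=
    hD x a q g S B r k j α p hx0 hx1 ha0 ha1 hq0 hq1 hg0 hg1 hr hk hxqg hband1 hband2 hB1 hta hSB hj hp hαp
  -- G = gate β a is DEC(J) at its mean a·S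
  obtain ⟨G0, GM, G1⟩ := gate_laws B β a ha0.le ha1 β0 βM β1
  have Gmean : ∑ h ∈ Finset.range (B + 1), (h : ℝ) * gate β a h = a * S := by rw [sum_mul_gate]
  have hdecJ : DECAtT (a * x) (a * S) J B (gate β a) := by
    rw [← Gmean, ← decAt_iff_decAtT]
    rcases Nat.lt_or_ge J B with hJlt | hJge
    · exact hS a ha0 ha1 J hJlt
    · refine decAt_of_top_le B (gate β a) G0 GM G1 (a * x) hy1 (fun h hh => ?_) J hJge
      have hhB : h ≤ B := by
        by_contra hc
        exact absurd (GM h (not_le.1 hc)) (ne_of_gt hh)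
      rw [Gmean]
      have h1 : a * x * (h : ℝ) ≤ a * x * (B : ℝ) := mul_le_mul_of_nonneg_left (by exact_mod_cast hhB) hy0.le
      have h2 : a * (x * (B : ℝ)) ≤ a * S := mul_le_mul_of_nonneg_left hta ha0.le
      linarith
  have wd := dual_le_of_decAtT (a * x) (a * S) J B (gate β a) hy0 hy1 hdecJ α' β' hβ' hαβ'
  have wd_eq := dual_functional_eq (a * S) J B α' β' (gate β a) hJB
  rw [gate_functional_eq B β (coefAt (a * S) J α' β') a] at wd_eq
  -- the mean identity
  have hmeanid : ∑ h ∈ Finset.range (B + 1), β h * (lam * ((h : ℝ) - S)) = 0 := by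
    have : ∑ h ∈ Finset.range (B + 1), β h * (lam * ((h : ℝ) - S))
        = lam * (∑ h ∈ Finset.range (B + 1), (h : ℝ) * β h - S * ∑ h ∈ Finset.range (B + 1), β h) := by
      rw [Finset.mul_sum, ← Finset.sum_sub_distrib, Finset.mul_sum]
      refine Finset.sum_congr rfl fun h _ => by ring
    rw [this, β1, mul_one, hSdef, sub_self, mul_zero]
  -- row-by-row domination
  have hle : ∑ h ∈ Finset.range (B + 1), β h * gluedPullback (a * (S + m)) q g j r k α p h
      ≤ ∑ h ∈ Finset.range (B + 1), β h * (coefAt (a * S) J α' β' h + lam * ((h : ℝ) - S)) :=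
    Finset.sum_le_sum fun h hh => mul_le_mul_of_nonneg_left (hrows h (Nat.lt_succ_iff.1 (Finset.mem_range.1 hh))) (β0 h)
  have hsplit : ∑ h ∈ Finset.range (B + 1), β h * (coefAt (a * S) J α' β' h + lam * ((h : ℝ) - S))
      = ∑ h ∈ Finset.range (B + 1), β h * coefAt (a * S) J α' β' h + ∑ h ∈ Finset.range (B + 1), β h * (lam * ((h : ℝ) - S)) := by
    rw [← Finset.sum_add_distrib]
    refine Finset.sum_congr rfl fun h _ => by ring
  rw [hsplit, hmeanid, add_zero] at hle
  have hΨ : ∀ h, (1 - q) * coefAt (a * (S + m)) j α p h + q * (1 - g) * coefAt (a * (S + m)) j α p (h + r)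
      + q * g * coefAt (a * (S + m)) j α p (h + r + k) = gluedPullback (a * (S + m)) q g j r k α p h := fun h => rfl
  simp_rw [hΨ] at hfun
  -- assemble
  have hG : (1 - a) * coefAt (a * S) J α' β' 0 + a * ∑ h ∈ Finset.range (B + 1), β h * coefAt (a * S) J α' β' h ≤ 0 := by
    rw [← wd_eq]; linarith
  have hfin : (1 - a) * coefAt (a * (S + m)) j α p 0 + a * ∑ h ∈ Finset.range (B + 1), β h * gluedPullback (a * (S + m)) q g j r k α p h ≤ 0 := by
    have := mul_le_mul_of_nonneg_left hle ha0.le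
    linarith
  linarith [hfun ▸ hfin]


/-- **`GluedDominated'` ⟹ THE GLUED-PIECE SLICE, ALL REGIMES** (the hypothesis `hGPS` of arm-1 g57's `sdec_cons_of_okPieces` verbatim): the band from
`sdec_gluedPiece_band_of_dominated'`, the rest from `gluedPieceSlice_of_band` (`…QuantGluedPieceSlice`). [this work] -/
theorem gluedPieceSlice_of_dominated' (hD : GluedDominated') {x : ℝ} (hx0 : 0 < x) (hx1 : x < 1) :
    ∀ (B' : ℕ) (β' : ℕ → ℝ) (r k : ℕ) (q g : ℝ), (∀ h, 0 ≤ β' h) → (∀ h, B' < h → β' h = 0) →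
      ∑ h ∈ Finset.range (B' + 1), β' h = 1 → x * (B' : ℝ) ≤ ∑ h ∈ Finset.range (B' + 1), (h : ℝ) * β' h → SDEC x B' β' →
      0 < q → q < 1 → 0 ≤ g → g ≤ 1 → 1 ≤ r → 1 ≤ k → x ≤ q * g → x * ((r : ℝ) + k) ≤ q * ((r : ℝ) + k * g) →
      SDEC x (B' + (r + k)) (lconv B' (r + k) β' (gate (TPL[r, k, g]) q)) :=
  gluedPieceSlice_of_band hx0 hx1 fun _ _ r k q g β0 βM β1 hta hS hq0 hq1 hg0 hg1 hr hk hxqg hb1 hb2 =>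
    sdec_gluedPiece_band_of_dominated' hD hx0 hx1 β0 βM β1 hta hS q g r k hq0 hq1 hg0 hg1 hr hk hxqg hb1 hb2

/-- **`GluedDominated'` ⟹ EVERY SIBLING WITH OK PIECES IS ADJOINABLE** (arm-1 g57's `sdec_cons_of_okPieces` with `hGPS` discharged from the guarded
conjecture). [this work] -/
theorem sdec_cons_of_okPieces_of_dominated' (hD : GluedDominated') {x : ℝ} (hx0 : 0 < x) (hx1 : x < 1)
    (L : List Sib) (s : Sib) (hL : ∀ t ∈ L, t.LawOK) (hxL : ∀ t ∈ L, x * (t.M : ℝ) ≤ t.q * t.mean) (hS : SDEC x (ftop L) (flaw L))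
    (hs : s.LawOK) (hxs : x * (s.M : ℝ) ≤ s.q * s.mean)
    {ι : Type} [Fintype ι] (w : ι → ℝ) (lo K : ι → ℕ) (γ : ι → ℝ)
    (hw0 : ∀ i, 0 ≤ w i) (hw1 : ∑ i, w i = 1) (hγ : ∀ i, 0 ≤ γ i ∧ γ i ≤ 1) (htop : ∀ i, lo i + K i ≤ s.M)
    (hmean : ∀ i, (lo i : ℝ) + K i * γ i = s.mean) (hmix : ∀ h, s.ρ h = ∑ i, w i * (TPL[lo i, K i, γ i]) h)
    (hOK : ∀ i, (K i : ℝ) * γ i ≤ lo i ∨ lo i = 0 ∨ x * (K i : ℝ) ≤ s.q * ((lo i : ℝ) + K i * γ i) - lo i ∨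
      (1 ≤ lo i ∧ 1 ≤ K i ∧ x ≤ s.q * γ i)) :
    SDEC x (ftop (s :: L)) (flaw (s :: L)) :=
  sdec_cons_of_okPieces hx0 hx1 (gluedPieceSlice_of_dominated' hD hx0 hx1) L s hL hxL hS hs hxs w lo K γ hw0 hw1 hγ htop hmean hmix hOK

end LawDec
end Quant
end Summit.CriticalPhenomena.PercolationContinuityZ3.Theorems
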